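import Literature.NumberTheory.EllipticCurves.BurungaleSkinnerTianWan2024.OrdinaryTwoVariableMainStatementReplayProofs
import Literature.NumberTheory.EllipticCurves.QuadraticTwistIrreducibleModPFieldProofs
import Literature.NumberTheory.EllipticCurves.QuadraticTwistJInvariantProofs
import HarnessLib

/-!
# BSTW arXiv:2409.01350v2 Thm. 10.10 (b), QUADRATIC-TWIST clauses (case `· = ∅`), REPLAYED IN THE
# KERNEL from the Thm. 10.5 twist binder — plus the tree lemma they need: irreducibility of `E[p]`
# over a number field `K` is invariant under quadratic twists (proofs only)

A *proofs* file (theorems only: no definition, no named fact, no instance, no `sorry`) written by the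
typer seat `bsd-littype-01` (gen 8) of the cross-ladder literature-typing layer (D-0088(4); cell
`run/shared/lean/pub/bsd-littype/`), third part of the gen-8 replay (after
`OrdinaryTwoVariableMainStatementOfDivisibilityProofs.lean` = pointwise layer and
`OrdinaryTwoVariableMainStatementReplayProofs.lean` = the case of `g` itself). Here: "Moreover, the same
holds for `g_K := g ⊗ χ_K` for any quadratic field extension `K/ℚ` with `(D_K, Np) = 1`" (Thm. 10.10,
last sentence, p. 89, tex l.7525), case `· = ∅`, for `g = f_{E₀}` — the conclusions of the gen-7 twist
binders `thm1010b_twist_standardMainStatement_twoVariable_OPEN` /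
`thm1010b_twist_greenbergMainStatement_twoVariable_OPEN` from the gen-8 twist binder
`thm105_twist_ordinary_twoVariableDivisibility_OPEN` (Thm. 10.5, last sentence) by the SAME template:
the cyclotomic statements for `g ⊗ χ_d` and `g ⊗ χ_d χ_L = g ⊗ χ_{d D_L}` (both instances of the
10.10 (a) twist binder O2 `thm1010_twist_mainStatement_OPEN`, or of [SU14] through the ARM-P reader's
`thm1010_twist_mainStatement_OPEN_of_skinnerUrban`), Yan–Zhu Lemma 5.3 / Prop. 3.7 / Cor. 2.9 /
Thm. 4.7 / Thm. 3.3 and BCS25 Thm. 4.1.3 (REFEREED) applied to the twisted curve `E₀^{(d)}` over `L`.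
HONEST FRAMING: typed ≠ proved ≠ endorsed; nothing here proves BSD or a main "conj."; every theorem is
CONDITIONAL on the named binders / facts it lists.

## The tree lemma it needs: quadratic twists preserve irreducibility of `E[p]` over `L`

The refereed Yan–Zhu inputs ask "`ρ̄_E|_{G_K}` irreducible" of the curve they are applied to — here
`E₀^{(d)}` over `L` — while the binder's hypothesis (irr_L) concerns `E₀`. The companion gen-8 file
`Literature/NumberTheory/EllipticCurves/QuadraticTwistIrreducibleModPFieldProofs.lean` proves the
field-general twist invariance (`hasIrreducibleModPGaloisRep_of_smul_eq_quadraticTwist_of_field`,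
Silverman AEC X.5 Cor. 5.4: the twist isomorphism is `G_K`-equivariant up to sign) and its base-change
corollary `hasIrreducibleModPGaloisRep_baseChange_of_smul_eq_quadraticTwist`, used in §3 (`irrK_twist`).

## Hypotheses versus the twist binders (numbers, not adjectives)

As in the `· = ∅` replay: THE cyclotomic/anticyclotomic coordinates with `γ₁|_{ℚ_∞}` the normalised
cyclotomic generator, and `D_L ≠ −3` for 9.12. IN ADDITION (print's twist clause allows any `K = ℚ(√d)`
with `(D_K, Np) = 1`, saying nothing about `d` versus `D_L`): `(d, D_L) = 1` (`hdD`) — so that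
`d · D_L` is square-free and O2 applies to `g ⊗ χ_{d D_L}` — and `(N_{E₀^{(d)}}, D_L) = 1` (`hNd`,
the `(N, D_K) = 1` of the Yan–Zhu facts for the twisted curve; it follows from `(d, D_L) = 1` and
`(N₀, D_L) = 1` since `N_{E₀^{(d)}} ∣ 2^∗ N₀ d²`, a conductor computation not composed here). WEAKER than
the binders by exactly these. Never stronger than print. Net: 0 definitions, 0 facts.

## References
* [BurungaleSkinnerTianWan2024] arXiv:2409.01350v2: Thm. 10.10, last sentence (p. 89; tex l.7525) and
  Thm. 10.5, last sentence (p. 88; l.7403); proof template = proof of Thm. 10.8 (pp. 88–89, l.7496–7514: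
  "The same argument applies for the quadratic twist g_K", l.7478).
* [SilvermanAEC2009] X.5 Cor. 5.4, X.2 Prop. 2.4 (the twist isomorphism).
* [YanZhu2024MainConjNonCM] J. Algebra 693 (2026): Cor. 2.9, Thm. 3.3, Prop. 3.7, Thm. 4.7, Lemma 5.3.
  [BurungaleCastellaSkinner2025] Thm. 4.1.3. [SkinnerUrban2014] Lemma 3.1.7, Thm. 3.6.9.
-/

noncomputable section

open scoped Classical

open PowerSeries NumberField IsDedekindDomain Field CongruenceSubgroup
  Literature.NumberTheory.GaloisRepresentations Literature.NumberTheory.EllipticCurves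
  Literature.NumberTheory.EllipticCurves.ModularForms Literature.NumberTheory.EllipticCurves.Rank1Residual

namespace Literature.NumberTheory.EllipticCurves.BurungaleSkinnerTianWan2024

open IwasawaAlgebra₂ YanZhu2026 BurungaleCastellaSkinner2025 SkinnerUrban2014
  Literature.NumberTheory.Automorphic

variable {p : ℕ} [Fact p.Prime]

/-! ## §3 (§1–§2 = `QuadraticTwistIrreducibleModPFieldProofs.lean`). The data of the twisted curve `E₀^{(d)}` over `L` under the twist binder's hypotheses -/

section TwistData

variable {W₀ W : WeierstrassCurve ℚ} [W₀.IsElliptic] [W₀.IsGloballyMinimal] [W.IsElliptic]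
  [W.IsGloballyMinimal] {d : ℤ} {C : WeierstrassCurve.VariableChange ℚ} {N₀ : ℕ} {K : Type} [Field K]
  [NumberField K]

/-- `p ∤ d` when every prime ramified in `ℚ(√d)` is `≠ p`. [cite: BurungaleSkinnerTianWan2024, Thm. 10.10, last sentence ("(D_K, Np) = 1") (bookkeeping)] -/
theorem not_dvd_of_ramifiedInQuadratic
    (hram : ∀ (q : ℕ) [Fact q.Prime], RamifiedInQuadratic d q → q ≠ p ∧ ¬ q ∣ N₀) :
    ¬ (p : ℤ) ∣ d := fun h ↦ (hram p (Or.inl h)).1 rfl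

omit [W.IsElliptic] in
/-- `E₀^{(d)}` is good ordinary at `p`. [cite: BurungaleSkinnerTianWan2024, Thm. 10.10, last sentence (bookkeeping)] -/
theorem goodOrd_twist (hyp : Thm1010bHypotheses W₀ p N₀ K) (hsq : Squarefree d)
    (hram : ∀ (q : ℕ) [Fact q.Prime], RamifiedInQuadratic d q → q ≠ p ∧ ¬ q ∣ N₀)
    (hC : C • W = W₀.quadraticTwist (d : ℚ)) : GoodOrd W p := by
  have h := isOrdinaryAt_of_smul_eq_quadraticTwist W₀ W hsq hC p hyp.two_ne
    (not_dvd_of_ramifiedInQuadratic hram) ⟨hyp.goodOrd.1, hyp.goodOrd.2⟩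
  exact ⟨h.1, h.2⟩

omit [W.IsElliptic] [W.IsGloballyMinimal] in
/-- (irr_L) for `E₀^{(d)}`. [cite: BurungaleSkinnerTianWan2024, Thm. 10.10, last sentence (bookkeeping)] -/
theorem irrK_twist (hyp : Thm1010bHypotheses W₀ p N₀ K) (hsq : Squarefree d)
    (hC : C • W = W₀.quadraticTwist (d : ℚ)) : (W.baseChange K).HasIrreducibleModPGaloisRep p :=
  hasIrreducibleModPGaloisRep_baseChange_of_smul_eq_quadraticTwist
    (show (d : ℚ) ≠ 0 by exact_mod_cast hsq.ne_zero) hC K hyp.irrK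

omit [W₀.IsElliptic] in
/-- `d · D_L` is square-free, `≠ 1`, and every prime ramified in `ℚ(√(d D_L))` is `≠ p` and prime to
`N₀` — the side conditions of the 10.10 (a) twist binder for `g ⊗ χ_{d D_L}`, GIVEN `(d, D_L) = 1`.
[cite: BurungaleSkinnerTianWan2024, Thm. 10.10, last sentence ("(D_K, Np) = 1") (bookkeeping)] -/
theorem twist_mul_discr_data (hyp : Thm1010bHypotheses W₀ p N₀ K) (hsq : Squarefree d)
    (hram : ∀ (q : ℕ) [Fact q.Prime], RamifiedInQuadratic d q → q ≠ p ∧ ¬ q ∣ N₀)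
    (hdD : IsCoprime d (NumberField.discr K)) :
    Squarefree (d * NumberField.discr K) ∧ d * NumberField.discr K ≠ 1 ∧
      ∀ (q : ℕ) [Fact q.Prime], RamifiedInQuadratic (d * NumberField.discr K) q →
        q ≠ p ∧ ¬ q ∣ W₀.conductorNorm ℤ := by
  obtain ⟨hsqD, hne1, h1⟩ := hyp.discr_squarefree
  obtain rfl : N₀ = W₀.conductorNorm ℤ := by exact_mod_cast hyp.level
  refine ⟨squarefree_mul_iff.mpr ⟨hdD.isRelPrime, hsq, hsqD⟩, fun h ↦ ?_, fun q hq hramq ↦ ?_⟩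
  · have hu : IsUnit (NumberField.discr K) := IsUnit.of_mul_eq_one_right d h
    rcases Int.isUnit_iff.mp hu with h' | h' <;> omega
  · rcases hramq with hdvd | ⟨rfl, h4⟩
    · rcases (Nat.prime_iff_prime_int.mp hq.out).dvd_or_dvd hdvd with hqd | hqD
      · exact hram q (Or.inl hqd)
      · exact hyp.ramifiedInQuadratic_discr q (Or.inl hqD)
    · refine hram 2 (Or.inr ⟨rfl, fun hd4 ↦ h4 ?_⟩)
      rw [Int.mul_emod, hd4, h1]
      decide

end TwistData

/-! ## §4. The twist clause of statement 9.10 (`∅`), reverse inclusion, from the 10.5 twist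
divisibility and the 10.10 (a) twist binder applied to `g ⊗ χ_d` and `g ⊗ χ_{d D_L}` -/

/-- **BSTW Thm. 10.10 (b), twist clause, statement 9.10 (`∅`) (b) for `g ⊗ χ_d` over `L`, REVERSE
INCLUSION, REPLAYED IN THE KERNEL** ("The same argument applies for the quadratic twist `g_K`",
l.7478): under the gen-7 twist binder's hypotheses (`Thm1010bHypotheses W₀ p N₀ K`; `d ≠ 1` square-free
with ramified primes `≠ p`, `∤ N₀`; `W` a globally minimal model of `E₀^{(d)}` with parametrisation `π` at
its conductor `N`) PLUS `(d, D_L) = 1` and `(N, D_L) = 1` (module docstring), on the cyclotomic /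
anticyclotomic coordinates with `γ₁` normalised: the two-variable divisibility `Char(X(E₀^{(d)}/L_∞)) ⊂
(𝓛)` (`hdiv`, the 10.5 twist binder) + the 10.10 (a) twist binder O2 (for `d` and for `d · D_L`) + Yan–Zhu
Lemma 5.3 / Prop. 3.7 + modularity ⟹ `(𝓛) ⊂ Char(X)`. CONDITIONAL; closes nothing by itself.
[claim: BurungaleSkinnerTianWan2024, status: under-review]
[cite: BurungaleSkinnerTianWan2024, Thm. 10.10, last sentence (p. 89; tex l.7525) with the proof of Thm. 10.8 (pp. 88–89, l.7478, l.7496–7510) and Thm. 10.5 (pp. 87–88)]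
[cite: YanZhu2024MainConjNonCM, Lemma 5.3, Prop. 3.7 (arXiv:2412.20078v4 TeX l.1086–1093, l.821–829)]
[cite: SilvermanAEC2009, X.5 Cor. 5.4] -/
theorem spanLeIdeal_perrinRiou_twist_of_idealLeSpan_of_thm1010_OPEN
    (hO2 : thm1010_twist_mainStatement_OPEN)
    (h53 : lemma53_charIdeal_mul_charIdeal_le_toPlus_charIdeal)
    (h37 : prop37_cycRestrict_perrinRiou_eq_padicLFunction_mul)
    (hmodpar : nonempty_modularParametrizationData)
    (ι : integralClosure ℚ ℂ →+* ℂ_[p]) (W₀ W : WeierstrassCurve ℚ) [W₀.IsElliptic]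
    [W₀.IsGloballyMinimal] [W.IsElliptic] [W.IsGloballyMinimal] (d : ℤ)
    (C : WeierstrassCurve.VariableChange ℚ) (K : Type) [Field K] [NumberField K]
    (κ₁ κ₂ : ZpExtension K p) (γ₁ γ₂ : absoluteGaloisGroup K)
    [Fact (ZpExtension.IsTopGeneratorPair κ₁ κ₂ γ₁ γ₂)] {N₀ N : ℕ} [NeZero N]
    (π : ModularParametrizationData W N) (hyp : Thm1010bHypotheses W₀ p N₀ K) (hsq : Squarefree d)
    (hd1 : d ≠ 1) (hram : ∀ (q : ℕ) [Fact q.Prime], RamifiedInQuadratic d q → q ≠ p ∧ ¬ q ∣ N₀)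
    (hC : C • W = W₀.quadraticTwist (d : ℚ)) (hN : (N : ℤ) = W.conductorNorm ℤ)
    (hdD : IsCoprime d (NumberField.discr K)) (hNd : IsCoprime (N : ℤ) (NumberField.discr K))
    (hκ₁ : κ₁.IsCyclotomic) (hκ₂ : κ₂.IsAnticyclotomic) (κ : ZpExtension ℚ p) (hκ : κ.IsCyclotomic)
    (hγ : κ.IsTopGenerator (absGaloisRestrict ℚ K γ₁))
    (hγ' : IsCyclotomicVariable p (absGaloisRestrict ℚ K γ₁))
    {F : CycAntiSeries p} (hF : IsHidaRankinLFunction ι W κ₁ κ₂ π.f F)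
    (hdiv : IdealLeSpan (WeierstrassCurve.XOrd₂.charIdeal (W.baseChange K) p κ₁ κ₂ γ₁ γ₂)
      (perrinRiouLFunction W π F)) :
    SpanLeIdeal (perrinRiouLFunction W π F)
      (WeierstrassCurve.XOrd₂.charIdeal (W.baseChange K) p κ₁ κ₂ γ₁ γ₂) := by
  have hram₀ : ∀ (q : ℕ) [Fact q.Prime], RamifiedInQuadratic d q → q ≠ p ∧ ¬ q ∣ W₀.conductorNorm ℤ := by
    intro q _ hq
    obtain ⟨h1, h2⟩ := hram q hq
    exact ⟨h1, fun h ↦ h2 (by exact_mod_cast (show ((q : ℕ) : ℤ) ∣ (N₀ : ℤ) by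
      rw [hyp.level]; exact_mod_cast h))⟩
  have hD0 : (NumberField.discr K : ℚ) ≠ 0 := by exact_mod_cast NumberField.discr_ne_zero K
  obtain ⟨hsq', hne1', hram'⟩ := twist_mul_discr_data hyp hsq hram hdD
  -- the twisted curve `E₀^{(d)}`: good ordinary, (irr_L), and its cyclotomic statement (O2 for `d`)
  have hordW : GoodOrd W p := goodOrd_twist hyp hsq hram hC
  have hirrKW : (W.baseChange K).HasIrreducibleModPGaloisRep p := irrK_twist hyp hsq hC
  have hE : CharIdealEqPadicLFunctionNeron W p :=
    hO2 W₀ W p d C hyp.two_ne hyp.semistable hyp.goodOrd.1 hyp.goodOrd.2 hyp.irrQ hsq hd1 hram₀ hC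
  -- a globally minimal model `W'` of `(E₀^{(d)})^{(D_L)} ≅ E₀^{(d D_L)}` with a modular parametrisation
  obtain ⟨W', hW'e, hW'm, C', hC'⟩ := exists_isGloballyMinimal_smul_eq_quadraticTwist W hD0
  haveI := hW'e
  haveI := hW'm
  haveI : NeZero (W'.conductorNorm ℤ) := ⟨(W'.conductorNorm_pos_holds).ne'⟩
  obtain ⟨π'⟩ := hmodpar W'
  have hord' : GoodOrd W' p := by
    have h := isOrdinaryAt_of_smul_eq_quadraticTwist_discr hyp.isImaginaryQuadratic.finrank_eq_two W W'
      hC' p hyp.two_ne hyp.not_dvd_discr ⟨hordW.1, hordW.2⟩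
    exact ⟨h.1, h.2⟩
  -- `W'` is a model of `E₀^{(d D_L)}`: `(V⁻¹ C') • W' = W₀^{(d D_L)}`
  set V : WeierstrassCurve.VariableChange ℚ := ⟨C⁻¹.u, (NumberField.discr K : ℚ) * C⁻¹.r, 0, 0⟩ with hV
  have hW : W = C⁻¹ • W₀.quadraticTwist (d : ℚ) := by rw [← hC, inv_smul_smul]
  have hC'' : (V⁻¹ * C') • W' = W₀.quadraticTwist ((d * NumberField.discr K : ℤ) : ℚ) := by
    rw [mul_smul, hC', hW, WeierstrassCurve.quadraticTwist_smul, ← hV, inv_smul_smul,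
      WeierstrassCurve.quadraticTwist_quadraticTwist]
    push_cast
    rfl
  have hEK : CharIdealEqPadicLFunctionNeron W' p :=
    hO2 W₀ W' p (d * NumberField.discr K) (V⁻¹ * C') hyp.two_ne hyp.semistable hyp.goodOrd.1
      hyp.goodOrd.2 hyp.irrQ hsq' hne1' hram' hC''
  exact spanLeIdeal_perrinRiou_of_idealLeSpan_of_charIdealEqNeron h53 h37 ι W K κ₁ κ₂ γ₁ γ₂ π κ W' π'
    hN hyp.three_le hordW hyp.isImaginaryQuadratic hyp.split hNd hirrKW hκ₁ hκ₂ hκ hγ hγ' ⟨C', hC'⟩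
    hord' hE hEK hF hdiv

/-! ## §5. THE REPLAY of the twist clauses of Thm. 10.10 (b), case `· = ∅`, by name -/

/-- **BSTW Thm. 10.10 (b), QUADRATIC-TWIST clause of statement 9.10 (`∅`) — the gen-7 binder
`thm1010b_twist_standardMainStatement_twoVariable_OPEN`'s conclusion (torsion of `X(E₀^{(d)}/L_∞)` ∧
for every Hida frame of `E₀^{(d)}`: `Char(X) ⊂ (𝓛)` ∧ `(𝓛) ⊂ Char(X)`) PROVED from the Thm. 10.5 twist
binder `thm105_twist_ordinary_twoVariableDivisibility_OPEN` (`h105`), the Thm. 10.10 (a) twist binder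
(`hO2`), the refereed Yan–Zhu Cor. 2.9 / Lemma 5.3 / Prop. 3.7 and modularity** — under the binder's
hypotheses PLUS `(d, D_L) = 1`, `(N, D_L) = 1` and the coordinate normalisation (module docstring).
CONDITIONAL; closes nothing by itself. [claim: BurungaleSkinnerTianWan2024, status: under-review]
[cite: BurungaleSkinnerTianWan2024, Thm. 10.10, last sentence (p. 89; tex l.7525), part (b), statement 9.10 case · = ∅; proof of Thm. 10.8 (pp. 88–89); Thm. 10.5, last sentence (p. 88)]
[cite: YanZhu2024MainConjNonCM, Cor. 2.9, Lemma 5.3, Prop. 3.7 (arXiv:2412.20078v4 TeX l.628–633, l.1086–1093, l.821–829)] -/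
theorem twistStandardMainStatement_twoVariable_of_thm105_twist_OPEN_of_thm1010_OPEN
    (h105 : thm105_twist_ordinary_twoVariableDivisibility_OPEN)
    (hO2 : thm1010_twist_mainStatement_OPEN) (h29 : cor29_XOrd₂_isTorsion)
    (h53 : lemma53_charIdeal_mul_charIdeal_le_toPlus_charIdeal)
    (h37 : prop37_cycRestrict_perrinRiou_eq_padicLFunction_mul)
    (hmodpar : nonempty_modularParametrizationData)
    (ι : integralClosure ℚ ℂ →+* ℂ_[p]) (W₀ W : WeierstrassCurve ℚ) [W₀.IsElliptic]
    [W₀.IsGloballyMinimal] [W.IsElliptic] [W.IsGloballyMinimal] (d : ℤ)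
    (C : WeierstrassCurve.VariableChange ℚ) (K : Type) [Field K] [NumberField K]
    (κ₁ κ₂ : ZpExtension K p) (γ₁ γ₂ : absoluteGaloisGroup K)
    [Fact (ZpExtension.IsTopGeneratorPair κ₁ κ₂ γ₁ γ₂)] {N₀ N : ℕ} [NeZero N]
    (π : ModularParametrizationData W N) (hyp : Thm1010bHypotheses W₀ p N₀ K) (hsq : Squarefree d)
    (hd1 : d ≠ 1) (hram : ∀ (q : ℕ) [Fact q.Prime], RamifiedInQuadratic d q → q ≠ p ∧ ¬ q ∣ N₀)
    (hC : C • W = W₀.quadraticTwist (d : ℚ)) (hN : (N : ℤ) = W.conductorNorm ℤ)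
    (hdD : IsCoprime d (NumberField.discr K)) (hNd : IsCoprime (N : ℤ) (NumberField.discr K))
    (hκ₁ : κ₁.IsCyclotomic) (hκ₂ : κ₂.IsAnticyclotomic) (κ : ZpExtension ℚ p) (hκ : κ.IsCyclotomic)
    (hγ : κ.IsTopGenerator (absGaloisRestrict ℚ K γ₁))
    (hγ' : IsCyclotomicVariable p (absGaloisRestrict ℚ K γ₁)) :
    Module.IsTorsion (IwasawaAlgebra₂ p) ((W.baseChange K).XOrd₂ p κ₁ κ₂ γ₁ γ₂) ∧
      ∀ F : CycAntiSeries p, IsHidaRankinLFunction ι W κ₁ κ₂ π.f F →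
        IdealLeSpan (WeierstrassCurve.XOrd₂.charIdeal (W.baseChange K) p κ₁ κ₂ γ₁ γ₂)
            (perrinRiouLFunction W π F) ∧
          SpanLeIdeal (perrinRiouLFunction W π F)
            (WeierstrassCurve.XOrd₂.charIdeal (W.baseChange K) p κ₁ κ₂ γ₁ γ₂) := by
  have hNW : IsCoprime (W.conductorNorm ℤ : ℤ) (NumberField.discr K) := hN ▸ hNd
  refine ⟨h29 W K κ₁ κ₂ γ₁ γ₂ hyp.three_le (goodOrd_twist hyp hsq hram hC) hyp.isImaginaryQuadratic
    hyp.split hNW (irrK_twist hyp hsq hC), fun F hF ↦ ⟨h105 ι W₀ W d C K κ₁ κ₂ γ₁ γ₂ π hyp hsq hd1 hram hC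
    hN F hF, ?_⟩⟩
  exact spanLeIdeal_perrinRiou_twist_of_idealLeSpan_of_thm1010_OPEN hO2 h53 h37 hmodpar ι W₀ W d C K κ₁
    κ₂ γ₁ γ₂ π hyp hsq hd1 hram hC hN hdD hNd hκ₁ hκ₂ κ hκ hγ hγ' hF
    (h105 ι W₀ W d C K κ₁ κ₂ γ₁ γ₂ π hyp hsq hd1 hram hC hN F hF)

/-- **The same with the Thm. 10.10 (a) twist binder fed by REFEREED print** ([SU14] `hSU`, `h5`, `h3`,
`hmod`, `hLL` through `thm1010_twist_mainStatement_OPEN_of_skinnerUrban`). CONDITIONAL; closes nothing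
by itself. [claim: BurungaleSkinnerTianWan2024, status: under-review]
[cite: BurungaleSkinnerTianWan2024, Thm. 10.10, last sentence and Rem. 10.11 (p. 89); Thm. 10.5 (pp. 87–88)]
[cite: SkinnerUrban2014, Thm. 3.6.9; Lemma 3.1.7] -/
theorem twistStandardMainStatement_twoVariable_of_thm105_twist_OPEN_of_skinnerUrban
    (h105 : thm105_twist_ordinary_twoVariableDivisibility_OPEN)
    (hSU : ∀ (W : WeierstrassCurve ℚ) [W.IsElliptic] [W.IsGloballyMinimal] (p : ℕ) [Fact p.Prime]
      (κ : ZpExtension ℚ p) (γ : Field.absoluteGaloisGroup ℚ) (N : ℕ) [NeZero N]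
      (f : CuspForm (Gamma0 N) 2),
      skinner_urban_main_conjecture W p (κ := κ) (γ := γ) (f := f))
    (h5 : realPeriodRat_eq_unit_mul_plusPeriod) (h3 : realPeriodRat_eq_unit_mul_plusPeriod_three)
    (hmod : exists_isNewformOf) (hLL : diamond1995_refinedSerre) (h29 : cor29_XOrd₂_isTorsion)
    (h53 : lemma53_charIdeal_mul_charIdeal_le_toPlus_charIdeal)
    (h37 : prop37_cycRestrict_perrinRiou_eq_padicLFunction_mul)
    (hmodpar : nonempty_modularParametrizationData)
    (ι : integralClosure ℚ ℂ →+* ℂ_[p]) (W₀ W : WeierstrassCurve ℚ) [W₀.IsElliptic]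
    [W₀.IsGloballyMinimal] [W.IsElliptic] [W.IsGloballyMinimal] (d : ℤ)
    (C : WeierstrassCurve.VariableChange ℚ) (K : Type) [Field K] [NumberField K]
    (κ₁ κ₂ : ZpExtension K p) (γ₁ γ₂ : absoluteGaloisGroup K)
    [Fact (ZpExtension.IsTopGeneratorPair κ₁ κ₂ γ₁ γ₂)] {N₀ N : ℕ} [NeZero N]
    (π : ModularParametrizationData W N) (hyp : Thm1010bHypotheses W₀ p N₀ K) (hsq : Squarefree d)
    (hd1 : d ≠ 1) (hram : ∀ (q : ℕ) [Fact q.Prime], RamifiedInQuadratic d q → q ≠ p ∧ ¬ q ∣ N₀)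
    (hC : C • W = W₀.quadraticTwist (d : ℚ)) (hN : (N : ℤ) = W.conductorNorm ℤ)
    (hdD : IsCoprime d (NumberField.discr K)) (hNd : IsCoprime (N : ℤ) (NumberField.discr K))
    (hκ₁ : κ₁.IsCyclotomic) (hκ₂ : κ₂.IsAnticyclotomic) (κ : ZpExtension ℚ p) (hκ : κ.IsCyclotomic)
    (hγ : κ.IsTopGenerator (absGaloisRestrict ℚ K γ₁))
    (hγ' : IsCyclotomicVariable p (absGaloisRestrict ℚ K γ₁)) :
    Module.IsTorsion (IwasawaAlgebra₂ p) ((W.baseChange K).XOrd₂ p κ₁ κ₂ γ₁ γ₂) ∧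
      ∀ F : CycAntiSeries p, IsHidaRankinLFunction ι W κ₁ κ₂ π.f F →
        IdealLeSpan (WeierstrassCurve.XOrd₂.charIdeal (W.baseChange K) p κ₁ κ₂ γ₁ γ₂)
            (perrinRiouLFunction W π F) ∧
          SpanLeIdeal (perrinRiouLFunction W π F)
            (WeierstrassCurve.XOrd₂.charIdeal (W.baseChange K) p κ₁ κ₂ γ₁ γ₂) :=
  twistStandardMainStatement_twoVariable_of_thm105_twist_OPEN_of_thm1010_OPEN h105
    (thm1010_twist_mainStatement_OPEN_of_skinnerUrban hSU h5 h3 hmod hLL) h29 h53 h37 hmodpar ι W₀ W d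
    C K κ₁ κ₂ γ₁ γ₂ π hyp hsq hd1 hram hC hN hdD hNd hκ₁ hκ₂ κ hκ hγ hγ'


/-! ## §6. The twist clause of statement 9.12 (`∅`) (Greenberg side) for `g ⊗ χ_d` over `L` -/

/-- **9.12-`∅` from both inclusions of 9.10-`∅`, for ANY curve in Yan–Zhu's `GreenbergSetting`** (the
pointwise layer's `greenbergMainStatement_twoVariable_of_idealLeSpan_of_spanLeIdeal` with the
hypothesis block replaced by `GreenbergSetting` + irreducibility over `K`, so that it applies to the
non-semistable twist `E₀^{(d)}`): Yan–Zhu Thm. 4.7 at `S = {1}` (`h47`), BCS25 Thm. 4.1.3 (`h413`),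
Yan–Zhu Cor. 2.9 (`h29`). CONDITIONAL; closes nothing by itself.
[cite: YanZhu2024MainConjNonCM, Thm. 4.7 (arXiv:2412.20078v4 TeX l.1022–1034), Cor. 2.9 (l.628–633)]
[cite: BurungaleCastellaSkinner2025, Thm. 4.1.3 (§4.1)]
[cite: BurungaleSkinnerTianWan2024, proof of Thm. 10.8, last sentence (tex l.7513) ("a consequence of Proposition 9.20")] -/
theorem greenbergMainStatement_twoVariable_of_idealLeSpan_of_spanLeIdeal_of_greenbergSetting
    (h47 : thm47_ord_localised_iff_greenbergAnyRoot_localised)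
    (h413 : thm413_ord_torsion_dvd_iff_greenberg_torsion_dvd) (h29 : cor29_XOrd₂_isTorsion)
    (ι₁ : integralClosure ℚ ℂ →+* ℂ_[p]) (ι : PadicAlgCl p ≃+* ℂ) (W : WeierstrassCurve ℚ) [W.IsElliptic]
    [W.IsGloballyMinimal] (K : Type) [Field K] [NumberField K] (v vbar : HeightOneSpectrum (𝓞 K))
    (κ₁ κ₂ : ZpExtension K p) (γ₁ γ₂ : absoluteGaloisGroup K)
    [Fact (ZpExtension.IsTopGeneratorPair κ₁ κ₂ γ₁ γ₂)] {N : ℕ} [NeZero N]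
    (π : ModularParametrizationData W N) [NeZero (NumberField.discr K).natAbs]
    (hset : GreenbergSetting ι W N K v vbar κ₁ κ₂)
    (hirrK : (W.baseChange K).HasIrreducibleModPGaloisRep p)
    (hι : ∀ z : integralClosure ℚ ℂ, ι₁ z = ((ι.symm (z : ℂ) : PadicAlgCl p) : ℂ_[p]))
    {F : CycAntiSeries p} (hF : IsHidaRankinLFunction ι₁ W κ₁ κ₂ π.f F) (hcF : IsCongruenceIntegral π.f F)
    (hle : IdealLeSpan (WeierstrassCurve.XOrd₂.charIdeal (W.baseChange K) p κ₁ κ₂ γ₁ γ₂)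
      (perrinRiouLFunction W π F))
    (hge : SpanLeIdeal (perrinRiouLFunction W π F)
      (WeierstrassCurve.XOrd₂.charIdeal (W.baseChange K) p κ₁ κ₂ γ₁ γ₂))
    {Ω δ : ℂ} {Ωp : (unrIntegers p)ˣ} {LK G : PowerSeries (PowerSeries (PadicComplexInt p))}
    (hLK : IsKatzMeasure₂ ι v vbar ∅ κ₁ κ₂ γ₁⁻¹ γ₂⁻¹ 1 Ω δ ((Ωp : unrIntegers p) : ℂ_[p]) LK)
    (hG : IsGreenbergLFunctionAnyRoot₂ ι v vbar κ₁ κ₂ γ₁⁻¹ γ₂⁻¹ π.f (NumberField.discr K).natAbs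
      (NumberField.classNumber K) LK G)
    (J : ℤ_[p] →+* PadicComplexInt p)
    (hJ : ∀ x : ℤ_[p], ((J x : PadicComplexInt p) : ℂ_[p]) = ((x : ℚ_[p]) : ℂ_[p])) :
    Module.IsTorsion (IwasawaAlgebra₂ p) ((W.baseChange K).XGr₂ p κ₁ κ₂ vbar γ₁ γ₂) ∧
      (WeierstrassCurve.XGr₂.charIdeal (W.baseChange K) p κ₁ κ₂ vbar γ₁ γ₂).map (toUnr₂ p J) =
        Ideal.span {G} := by
  have htor : Module.IsTorsion (IwasawaAlgebra₂ p) ((W.baseChange K).XOrd₂ p κ₁ κ₂ γ₁ γ₂) :=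
    h29 W K κ₁ κ₂ γ₁ γ₂ hset.three_le hset.goodOrd hset.isImaginaryQuadratic hset.split
      (hset.level ▸ hset.coprime) hirrK
  refine ⟨xGr₂_isTorsion_of_thm413 ι₁ ι W v vbar κ₁ κ₂ γ₁ γ₂ π h413 hset hirrK hι hF hcF hLK hG hJ htor
    hle, le_antisymm ?_ ?_⟩
  · have h := (h47 ι₁ ι W K v vbar κ₁ κ₂ γ₁ γ₂ π hset hirrK hι F hF hcF Ω δ Ωp LK G hLK hG J hJ 1
      one_ne_zero).1
    rw [idealLeSpanAway_one_iff, map_one, exists_span_one_pow_mul_le_iff] at h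
    exact h.mp hle
  · exact span_le_charIdealXGr₂_map_of_spanLeIdeal h47 ι₁ ι W K v vbar κ₁ κ₂ γ₁ γ₂ π hset hirrK hι hF
      hcF hLK hG J hJ hge

/-- **BSTW Thm. 10.10 (b), QUADRATIC-TWIST clause of statement 9.12 (`∅`) — the gen-7 binder
`thm1010b_twist_greenbergMainStatement_twoVariable_OPEN`'s conclusion (torsion of `X_Gr(E₀^{(d)}/L_∞)` ∧
`char(X_Gr)𝒪_{ℂ_p}⟦T₁,T₂⟧ = (G')` for every reduction-type-free Greenberg frame `G'` of the newform `f`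
of `E₀^{(d)}` and every structure-compatible `J`) PROVED from the Thm. 10.5 twist binder (`h105`), the
Thm. 10.10 (a) twist binder (`hO2`) and REFEREED print** (Yan–Zhu Cor. 2.9 / Thm. 3.3 / Lemma 5.3 /
Prop. 3.7 / Thm. 4.7, BCS25 Thm. 4.1.3, modularity) — under the binder's hypotheses PLUS `(d, D_L) = 1`,
`(N, D_L) = 1`, `D_L ≠ −3` and the coordinate normalisation (module docstring). CONDITIONAL; closes
nothing by itself. [claim: BurungaleSkinnerTianWan2024, status: under-review]
[cite: BurungaleSkinnerTianWan2024, Thm. 10.10, last sentence (p. 89; tex l.7525), part (b), statement 9.12 case · = ∅; proof of Thm. 10.8 (pp. 88–89, l.7513); Thm. 10.5 (pp. 87–88)]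
[cite: YanZhu2024MainConjNonCM, Thm. 4.7, Thm. 3.3, Cor. 2.9 (arXiv:2412.20078v4 TeX l.1022–1034, l.738–752, l.628–633)]
[cite: BurungaleCastellaSkinner2025, Thm. 4.1.3 (§4.1)] -/
theorem twistGreenbergMainStatement_twoVariable_of_thm105_twist_OPEN_of_thm1010_OPEN
    (h105 : thm105_twist_ordinary_twoVariableDivisibility_OPEN)
    (hO2 : thm1010_twist_mainStatement_OPEN) (h29 : cor29_XOrd₂_isTorsion)
    (h33 : thm33_exists_isHidaRankinLFunction)
    (h53 : lemma53_charIdeal_mul_charIdeal_le_toPlus_charIdeal)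
    (h37 : prop37_cycRestrict_perrinRiou_eq_padicLFunction_mul)
    (h47 : thm47_ord_localised_iff_greenbergAnyRoot_localised)
    (h413 : thm413_ord_torsion_dvd_iff_greenberg_torsion_dvd)
    (hmodpar : nonempty_modularParametrizationData)
    (ι₁ : integralClosure ℚ ℂ →+* ℂ_[p]) (ι : PadicAlgCl p ≃+* ℂ) (W₀ W : WeierstrassCurve ℚ)
    [W₀.IsElliptic] [W₀.IsGloballyMinimal] [W.IsElliptic] [W.IsGloballyMinimal] (d : ℤ)
    (C : WeierstrassCurve.VariableChange ℚ) (K : Type) [Field K] [NumberField K]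
    (v vbar : HeightOneSpectrum (𝓞 K)) (κ₁ κ₂ : ZpExtension K p) (γ₁ γ₂ : absoluteGaloisGroup K)
    [Fact (ZpExtension.IsTopGeneratorPair κ₁ κ₂ γ₁ γ₂)] {N₀ N : ℕ} [NeZero N]
    {f : CuspForm (Gamma0 N) 2} (hf : IsNewformOf W f) [NeZero (NumberField.discr K).natAbs]
    (hyp : Thm1010bHypotheses W₀ p N₀ K) (hsq : Squarefree d) (hd1 : d ≠ 1)
    (hram : ∀ (q : ℕ) [Fact q.Prime], RamifiedInQuadratic d q → q ≠ p ∧ ¬ q ∣ N₀)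
    (hC : C • W = W₀.quadraticTwist (d : ℚ)) (hN : (N : ℤ) = W.conductorNorm ℤ)
    (hdD : IsCoprime d (NumberField.discr K)) (hNd : IsCoprime (N : ℤ) (NumberField.discr K))
    (hv : ((p : ℕ) : 𝓞 K) ∈ v.asIdeal) (hvbar : ((p : ℕ) : 𝓞 K) ∈ vbar.asIdeal) (hne : vbar ≠ v)
    (hcompat : ∀ (w : InfinitePlace K) (k : 𝓞 K), k ∈ v.asIdeal ↔ ‖ι.symm (w.embedding (k : K))‖ < 1)
    (hκ₁ : κ₁.IsCyclotomic) (hκ₂ : κ₂.IsAnticyclotomic) (hD3 : NumberField.discr K ≠ -3)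
    (hι : ∀ z : integralClosure ℚ ℂ, ι₁ z = ((ι.symm (z : ℂ) : PadicAlgCl p) : ℂ_[p]))
    (κ : ZpExtension ℚ p) (hκ : κ.IsCyclotomic) (hγ : κ.IsTopGenerator (absGaloisRestrict ℚ K γ₁))
    (hγ' : IsCyclotomicVariable p (absGaloisRestrict ℚ K γ₁))
    {Ω δ : ℂ} {Ωp : (unrIntegers p)ˣ} {LK G' : PowerSeries (PowerSeries (PadicComplexInt p))}
    (hLK : IsKatzMeasure₂ ι v vbar ∅ κ₁ κ₂ γ₁⁻¹ γ₂⁻¹ 1 Ω δ ((Ωp : unrIntegers p) : ℂ_[p]) LK)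
    (hG : IsGreenbergLFunctionAnyRoot₂ ι v vbar κ₁ κ₂ γ₁⁻¹ γ₂⁻¹ f (NumberField.discr K).natAbs
      (NumberField.classNumber K) LK G')
    (J : ℤ_[p] →+* PadicComplexInt p)
    (hJ : ∀ x : ℤ_[p], ((J x : PadicComplexInt p) : ℂ_[p]) = ((x : ℚ_[p]) : ℂ_[p])) :
    Module.IsTorsion (IwasawaAlgebra₂ p) ((W.baseChange K).XGr₂ p κ₁ κ₂ vbar γ₁ γ₂) ∧
      (WeierstrassCurve.XGr₂.charIdeal (W.baseChange K) p κ₁ κ₂ vbar γ₁ γ₂).map (toUnr₂ p J) =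
        Ideal.span {G'} := by
  -- a modular parametrisation of the twist at its conductor, whose newform is `f`
  obtain rfl : N = W.conductorNorm ℤ := by exact_mod_cast hN
  obtain ⟨π⟩ := hmodpar W
  obtain rfl : f = π.f := hf.unique π.isNewformOf
  have hordW : GoodOrd W p := goodOrd_twist hyp hsq hram hC
  have hset : GreenbergSetting ι W (W.conductorNorm ℤ) K v vbar κ₁ κ₂ :=
    { level := hN, three_le := hyp.three_le, goodOrd := hordW,
      isImaginaryQuadratic := hyp.isImaginaryQuadratic, split := hyp.split, mem_v := hv,
      mem_vbar := hvbar, vbar_ne := hne, compat := hcompat, coprime := hNd,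
      discr_odd := hyp.discr_odd, discr_ne := hD3, cyclotomic := hκ₁, anticyclotomic := hκ₂ }
  -- a congruence-integral Hida frame for the twist (Yan–Zhu Thm. 3.3)
  obtain ⟨F, hF, hcF⟩ := h33 ι₁ W K κ₁ κ₂ γ₁ γ₂ π.isNewformOf hN hyp.three_le hordW
    hyp.isImaginaryQuadratic hyp.split hNd
  have hle := h105 ι₁ W₀ W d C K κ₁ κ₂ γ₁ γ₂ π hyp hsq hd1 hram hC hN F hF
  have hge := spanLeIdeal_perrinRiou_twist_of_idealLeSpan_of_thm1010_OPEN hO2 h53 h37 hmodpar ι₁ W₀ W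
    d C K κ₁ κ₂ γ₁ γ₂ π hyp hsq hd1 hram hC hN hdD hNd hκ₁ hκ₂ κ hκ hγ hγ' hF hle
  exact greenbergMainStatement_twoVariable_of_idealLeSpan_of_spanLeIdeal_of_greenbergSetting h47 h413
    h29 ι₁ ι W K v vbar κ₁ κ₂ γ₁ γ₂ π hset (irrK_twist hyp hsq hC) hι hF hcF hle hge hLK hG J hJ

/-- **The same with the Thm. 10.10 (a) twist binder fed by REFEREED print** ([SU14] `hSU`, `h5`, `h3`,
`hmod`, `hLL`). CONDITIONAL; closes nothing by itself. [claim: BurungaleSkinnerTianWan2024, status: under-review]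
[cite: BurungaleSkinnerTianWan2024, Thm. 10.10, last sentence and Rem. 10.11 (p. 89); Thm. 10.5 (pp. 87–88)]
[cite: YanZhu2024MainConjNonCM, Thm. 4.7 (arXiv:2412.20078v4 TeX l.1022–1034)] [cite: BurungaleCastellaSkinner2025, Thm. 4.1.3 (§4.1)] -/
theorem twistGreenbergMainStatement_twoVariable_of_thm105_twist_OPEN_of_skinnerUrban
    (h105 : thm105_twist_ordinary_twoVariableDivisibility_OPEN)
    (hSU : ∀ (W : WeierstrassCurve ℚ) [W.IsElliptic] [W.IsGloballyMinimal] (p : ℕ) [Fact p.Prime]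
      (κ : ZpExtension ℚ p) (γ : Field.absoluteGaloisGroup ℚ) (N : ℕ) [NeZero N]
      (f : CuspForm (Gamma0 N) 2),
      skinner_urban_main_conjecture W p (κ := κ) (γ := γ) (f := f))
    (h5 : realPeriodRat_eq_unit_mul_plusPeriod) (h3 : realPeriodRat_eq_unit_mul_plusPeriod_three)
    (hmod : exists_isNewformOf) (hLL : diamond1995_refinedSerre) (h29 : cor29_XOrd₂_isTorsion)
    (h33 : thm33_exists_isHidaRankinLFunction)
    (h53 : lemma53_charIdeal_mul_charIdeal_le_toPlus_charIdeal)
    (h37 : prop37_cycRestrict_perrinRiou_eq_padicLFunction_mul)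
    (h47 : thm47_ord_localised_iff_greenbergAnyRoot_localised)
    (h413 : thm413_ord_torsion_dvd_iff_greenberg_torsion_dvd)
    (hmodpar : nonempty_modularParametrizationData)
    (ι₁ : integralClosure ℚ ℂ →+* ℂ_[p]) (ι : PadicAlgCl p ≃+* ℂ) (W₀ W : WeierstrassCurve ℚ)
    [W₀.IsElliptic] [W₀.IsGloballyMinimal] [W.IsElliptic] [W.IsGloballyMinimal] (d : ℤ)
    (C : WeierstrassCurve.VariableChange ℚ) (K : Type) [Field K] [NumberField K]
    (v vbar : HeightOneSpectrum (𝓞 K)) (κ₁ κ₂ : ZpExtension K p) (γ₁ γ₂ : absoluteGaloisGroup K)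
    [Fact (ZpExtension.IsTopGeneratorPair κ₁ κ₂ γ₁ γ₂)] {N₀ N : ℕ} [NeZero N]
    {f : CuspForm (Gamma0 N) 2} (hf : IsNewformOf W f) [NeZero (NumberField.discr K).natAbs]
    (hyp : Thm1010bHypotheses W₀ p N₀ K) (hsq : Squarefree d) (hd1 : d ≠ 1)
    (hram : ∀ (q : ℕ) [Fact q.Prime], RamifiedInQuadratic d q → q ≠ p ∧ ¬ q ∣ N₀)
    (hC : C • W = W₀.quadraticTwist (d : ℚ)) (hN : (N : ℤ) = W.conductorNorm ℤ)
    (hdD : IsCoprime d (NumberField.discr K)) (hNd : IsCoprime (N : ℤ) (NumberField.discr K))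
    (hv : ((p : ℕ) : 𝓞 K) ∈ v.asIdeal) (hvbar : ((p : ℕ) : 𝓞 K) ∈ vbar.asIdeal) (hne : vbar ≠ v)
    (hcompat : ∀ (w : InfinitePlace K) (k : 𝓞 K), k ∈ v.asIdeal ↔ ‖ι.symm (w.embedding (k : K))‖ < 1)
    (hκ₁ : κ₁.IsCyclotomic) (hκ₂ : κ₂.IsAnticyclotomic) (hD3 : NumberField.discr K ≠ -3)
    (hι : ∀ z : integralClosure ℚ ℂ, ι₁ z = ((ι.symm (z : ℂ) : PadicAlgCl p) : ℂ_[p]))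
    (κ : ZpExtension ℚ p) (hκ : κ.IsCyclotomic) (hγ : κ.IsTopGenerator (absGaloisRestrict ℚ K γ₁))
    (hγ' : IsCyclotomicVariable p (absGaloisRestrict ℚ K γ₁))
    {Ω δ : ℂ} {Ωp : (unrIntegers p)ˣ} {LK G' : PowerSeries (PowerSeries (PadicComplexInt p))}
    (hLK : IsKatzMeasure₂ ι v vbar ∅ κ₁ κ₂ γ₁⁻¹ γ₂⁻¹ 1 Ω δ ((Ωp : unrIntegers p) : ℂ_[p]) LK)
    (hG : IsGreenbergLFunctionAnyRoot₂ ι v vbar κ₁ κ₂ γ₁⁻¹ γ₂⁻¹ f (NumberField.discr K).natAbs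
      (NumberField.classNumber K) LK G')
    (J : ℤ_[p] →+* PadicComplexInt p)
    (hJ : ∀ x : ℤ_[p], ((J x : PadicComplexInt p) : ℂ_[p]) = ((x : ℚ_[p]) : ℂ_[p])) :
    Module.IsTorsion (IwasawaAlgebra₂ p) ((W.baseChange K).XGr₂ p κ₁ κ₂ vbar γ₁ γ₂) ∧
      (WeierstrassCurve.XGr₂.charIdeal (W.baseChange K) p κ₁ κ₂ vbar γ₁ γ₂).map (toUnr₂ p J) =
        Ideal.span {G'} :=
  twistGreenbergMainStatement_twoVariable_of_thm105_twist_OPEN_of_thm1010_OPEN h105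
    (thm1010_twist_mainStatement_OPEN_of_skinnerUrban hSU h5 h3 hmod hLL) h29 h33 h53 h37 h47 h413
    hmodpar ι₁ ι W₀ W d C K v vbar κ₁ κ₂ γ₁ γ₂ hf hyp hsq hd1 hram hC hN hdD hNd hv hvbar hne hcompat hκ₁ hκ₂
    hD3 hι κ hκ hγ hγ' hLK hG J hJ

end Literature.NumberTheory.EllipticCurves.BurungaleSkinnerTianWan2024

end
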